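/-
Copyright (c) 2026. All rights reserved.
Released under Apache 2.0 license as described in the file LICENSE.
Authors: abc-iut cell, seat abc-iut-L4-t14 (gen 5; proof-only composition: the ARITHMETIC cusped geometric
column of [AbsTopIII] Prop 4.2 (i) / Cor 4.5 at the uniformised model — `hfin` by abc-iut-L4-t12's
`hfin_of_isArithmetic`, `hN`/`hN'` by abc-iut-L4-d1's cusped normaliser finiteness).
-/
import Literature.AnabelianGeometry.AbsoluteAnabelian.ArchimedeanHolFieldFunctorGeometricPSLCusped
import Literature.AnabelianGeometry.AbsoluteAnabelian.ArchimedeanHolFieldFunctorGeometricPSLArithmeticHfin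
import HarnessLib

/-!
# [AbsTopIII] Prop 4.2 (i) at the uniformised model over an ARITHMETIC cusped base: only cusp data left

S. Mochizuki, *Topics in absolute anabelian geometry III*, proof of Prop 4.2 (i) p. 106 l. 14–19 (kurims
`paper:url-5493eb38cbb7`; bib key `MochizukiAbsTopIII2015`).  abc-iut-L4-t14's uniformised-model closers
for «objects of `EA` mapping to `X₀ = ℍ/Γ̄` are id-rigid» and Cor 4.5 (p449027 holomorphic, p456078 RC)
carried two analytic binders: `hfin` (the conjugation-induced maps `ℍ/gΛ̄₁g⁻¹ → ℍ/Λ̄₂` are FINITE étale)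
and `hN`/`hN'` (`Aut(ℍ/Λ̄)` finite).  For an ARITHMETIC `Γ̄` (lift to `GL(2, ℝ)` commensurable with
`SL(2, ℤ)`, Mathlib's `Subgroup.IsArithmetic`) abc-iut-L4-t12 discharged `hfin`
(`HolRS.hfin_of_isArithmetic`, p463658: cusps `= ℙ¹(ℚ)`, widths), and for a cusped `Γ̄` with (P) a
parabolic and (FC) finitely many cusp classes abc-iut-L4-d1 discharged `hN` at every object (p460349 /
p461233, wired in `…GeometricPSLCusped.lean`, p464663).

PROOF-ONLY composition (no definition, no named fact): for `Γ̄ ≤ PSL₂(ℝ)` ARITHMETIC, free of finite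
rank or an orientable surface group, non-abelian, acting freely and properly discontinuously on `ℍ`, with
(P)+(FC):

* ★★ `HolRS.isIdRigid_EA_mapsTo_pslQuotient_of_cusps_of_isArithmetic` /
  `HolRS.cor_4_5_geometric_mapsTo_pslQuotient_of_cusps_of_isArithmetic` — the holomorphic column with NO
  analytic binder left (hypotheses = structure + the cusp data (P), (FC));
* ★★ `HolRS.RC.…_of_cusps_of_isArithmetic` — the PRINT-FAITHFUL (RC) twins;
* the IUT shapes `…_of_cusps_of_isArithmetic_of_isFreeGroup` (`Γ̄` free on finitely many, `≥ 2`,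
  generators — e.g. `Γ̄ = π(Λ)` for a torsion-free finite-index `Λ ≤ SL(2, ℤ)` such as abc-iut-L4-d1's
  `Γ̄(2)`, where `[IsArithmetic]` is abc-iut-L4-t12's `isArithmetic_map_comap_of_subgroup_SL2Z Λ`).

What remains at a CONCRETE arithmetic base is group-theoretic and finite: (P), (FC), proper discontinuity,
freeness of the action and of `Γ̄` — abc-iut-L4-d1's row «J2i-GAMMA2-MODEL» for `Γ̄(2)`.  HONEST SCOPE:
MODEL side of [AbsTopIII] §4 (model ≠ reconstruction); an arithmetic base `ℍ/Γ̄(2)` is NOT identified with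
the printed tripod `ℙ¹ ∖ {0,1,∞}` here (that is the `λ`-function, campaign-L); orbi objects and `EA` beyond
one `X₀` untouched.  Classical; nothing here bears on [IUTchIII] Cor. 3.12.
-/

set_option autoImplicit false

noncomputable section

open scoped UpperHalfPlane MatrixGroups Matrix
open _root_.MulAction _root_.CategoryTheory
open Literature.IUT.HodgeTheaters (IsFreeOrSurface)
open Matrix.SpecialLinearGroup (toGL)

namespace Literature.AnabelianGeometry.AbsoluteAnabelian

namespace HolRS

variable (Γ : Subgroup PSL2R) [ProperlyDiscontinuousSMul Γ ℍ] [IsCancelSMul Γ ℍ]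

/-! ### `Γ̄` arithmetic, free-or-surface -/

/-- ★★ **[AbsTopIII] Prop 4.2 (i) at the uniformised model over an ARITHMETIC cusped base**: for
`Γ̄ ≤ PSL₂(ℝ)` arithmetic, free of finite rank or an orientable surface group, non-abelian, acting freely
and properly discontinuously on `ℍ`, with (P) a parabolic and (FC) finitely many cusp classes, the geometric
`EA` over `X₀ = ℍ/Γ̄` is ID-RIGID — NO analytic binder: `hfin` by abc-iut-L4-t12's `hfin_of_isArithmetic`,
`hN` by abc-iut-L4-d1. [cite: MochizukiAbsTopIII2015, Proposition 4.2 (i) proof p.106] -/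
theorem isIdRigid_EA_mapsTo_pslQuotient_of_cusps_of_isArithmetic (hΓ : IsFreeOrSurface Γ)
    [((Γ.comap (QuotientGroup.mk' (Subgroup.center SL(2, ℝ)))).map
      (toGL : SL(2, ℝ) →* GL (Fin 2) ℝ)).IsArithmetic]
    (hab : ∃ a b : Γ, a * b ≠ b * a)
    (hP : ∃ t : SL(2, ℝ), QuotientGroup.mk' (Subgroup.center SL(2, ℝ)) t ∈ Γ ∧
      (t : Matrix (Fin 2) (Fin 2) ℝ).IsParabolic)
    (hFC : ∃ F : Finset (Fin 2 → ℝ), ∀ t : SL(2, ℝ),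
      QuotientGroup.mk' (Subgroup.center SL(2, ℝ)) t ∈ Γ → (t : Matrix (Fin 2) (Fin 2) ℝ).IsParabolic →
      ∀ v : Fin 2 → ℝ, v ≠ 0 → (∃ c : ℝ, (t : Matrix (Fin 2) (Fin 2) ℝ) *ᵥ v = c • v) →
      ∃ g : SL(2, ℝ), QuotientGroup.mk' (Subgroup.center SL(2, ℝ)) g ∈ Γ ∧ ∃ w ∈ F, ∃ c : ℝ,
        (g : Matrix (Fin 2) (Fin 2) ℝ) *ᵥ v = c • w) :
    IsIdRigid (geometricAutHolFieldFunctor fun Y : HolRS => Nonempty (Y ⟶ pslQuotient Γ)).EA :=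
  isIdRigid_EA_mapsTo_pslQuotient_of_cusps Γ (hfin_of_isArithmetic Γ) hΓ hab hP hFC

/-- ★★ **[AbsTopIII] Cor 4.5 (i)–(v) over an ARITHMETIC cusped base** `X₀ = ℍ/Γ̄` (`Γ̄` arithmetic,
free-or-surface, non-abelian, acting freely and properly discontinuously, with (P)+(FC)) — no analytic
binder. [cite: MochizukiAbsTopIII2015, Corollary 4.5 pp.107–109] -/
theorem cor_4_5_geometric_mapsTo_pslQuotient_of_cusps_of_isArithmetic (hΓ : IsFreeOrSurface Γ)
    [((Γ.comap (QuotientGroup.mk' (Subgroup.center SL(2, ℝ)))).map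
      (toGL : SL(2, ℝ) →* GL (Fin 2) ℝ)).IsArithmetic]
    (hab : ∃ a b : Γ, a * b ≠ b * a)
    (hP : ∃ t : SL(2, ℝ), QuotientGroup.mk' (Subgroup.center SL(2, ℝ)) t ∈ Γ ∧
      (t : Matrix (Fin 2) (Fin 2) ℝ).IsParabolic)
    (hFC : ∃ F : Finset (Fin 2 → ℝ), ∀ t : SL(2, ℝ),
      QuotientGroup.mk' (Subgroup.center SL(2, ℝ)) t ∈ Γ → (t : Matrix (Fin 2) (Fin 2) ℝ).IsParabolic →
      ∀ v : Fin 2 → ℝ, v ≠ 0 → (∃ c : ℝ, (t : Matrix (Fin 2) (Fin 2) ℝ) *ᵥ v = c • v) →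
      ∃ g : SL(2, ℝ), QuotientGroup.mk' (Subgroup.center SL(2, ℝ)) g ∈ Γ ∧ ∃ w ∈ F, ∃ c : ℝ,
        (g : Matrix (Fin 2) (Fin 2) ℝ) *ᵥ v = c • w) :
    Literature.AnabelianGeometry.AbsoluteAnabelian.AbsTopIII.Cor_4_5
      (archLogFrobeniusData (geometricAutHolFieldFunctor fun Y : HolRS => Nonempty (Y ⟶ pslQuotient Γ)))
      (archTelecoreData (geometricAutHolFieldFunctor fun Y : HolRS => Nonempty (Y ⟶ pslQuotient Γ))) :=
  cor_4_5_geometric_mapsTo_pslQuotient_of_cusps Γ (hfin_of_isArithmetic Γ) hΓ hab hP hFC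

/-- ★★ **[AbsTopIII] Prop 4.2 (i), PRINT-FAITHFUL (RC) morphisms, ARITHMETIC cusped base**: the geometric
`EA` of the RC instance over `X₀ = ℍ/Γ̄` is ID-RIGID (same hypotheses; no analytic binder).
[cite: MochizukiAbsTopIII2015, Proposition 4.2 (i) proof p.106] -/
theorem RC.isIdRigid_EA_mapsTo_pslQuotient_of_cusps_of_isArithmetic (hΓ : IsFreeOrSurface Γ)
    [((Γ.comap (QuotientGroup.mk' (Subgroup.center SL(2, ℝ)))).map
      (toGL : SL(2, ℝ) →* GL (Fin 2) ℝ)).IsArithmetic]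
    (hab : ∃ a b : Γ, a * b ≠ b * a)
    (hP : ∃ t : SL(2, ℝ), QuotientGroup.mk' (Subgroup.center SL(2, ℝ)) t ∈ Γ ∧
      (t : Matrix (Fin 2) (Fin 2) ℝ).IsParabolic)
    (hFC : ∃ F : Finset (Fin 2 → ℝ), ∀ t : SL(2, ℝ),
      QuotientGroup.mk' (Subgroup.center SL(2, ℝ)) t ∈ Γ → (t : Matrix (Fin 2) (Fin 2) ℝ).IsParabolic →
      ∀ v : Fin 2 → ℝ, v ≠ 0 → (∃ c : ℝ, (t : Matrix (Fin 2) (Fin 2) ℝ) *ᵥ v = c • v) →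
      ∃ g : SL(2, ℝ), QuotientGroup.mk' (Subgroup.center SL(2, ℝ)) g ∈ Γ ∧ ∃ w ∈ F, ∃ c : ℝ,
        (g : Matrix (Fin 2) (Fin 2) ℝ) *ᵥ v = c • w) :
    IsIdRigid (geometricAutHolFieldFunctorRC fun Y : RC => Nonempty (Y ⟶ toRC.obj (pslQuotient Γ))).EA :=
  RC.isIdRigid_EA_mapsTo_pslQuotient_of_cusps Γ (hfin_of_isArithmetic Γ) hΓ hab hP hFC

/-- ★★ **[AbsTopIII] Cor 4.5 (i)–(v), PRINT-FAITHFUL morphisms, ARITHMETIC cusped base** (same hypotheses;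
no analytic binder). [cite: MochizukiAbsTopIII2015, Corollary 4.5 pp.107–109] -/
theorem RC.cor_4_5_geometric_mapsTo_pslQuotient_of_cusps_of_isArithmetic (hΓ : IsFreeOrSurface Γ)
    [((Γ.comap (QuotientGroup.mk' (Subgroup.center SL(2, ℝ)))).map
      (toGL : SL(2, ℝ) →* GL (Fin 2) ℝ)).IsArithmetic]
    (hab : ∃ a b : Γ, a * b ≠ b * a)
    (hP : ∃ t : SL(2, ℝ), QuotientGroup.mk' (Subgroup.center SL(2, ℝ)) t ∈ Γ ∧
      (t : Matrix (Fin 2) (Fin 2) ℝ).IsParabolic)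
    (hFC : ∃ F : Finset (Fin 2 → ℝ), ∀ t : SL(2, ℝ),
      QuotientGroup.mk' (Subgroup.center SL(2, ℝ)) t ∈ Γ → (t : Matrix (Fin 2) (Fin 2) ℝ).IsParabolic →
      ∀ v : Fin 2 → ℝ, v ≠ 0 → (∃ c : ℝ, (t : Matrix (Fin 2) (Fin 2) ℝ) *ᵥ v = c • v) →
      ∃ g : SL(2, ℝ), QuotientGroup.mk' (Subgroup.center SL(2, ℝ)) g ∈ Γ ∧ ∃ w ∈ F, ∃ c : ℝ,
        (g : Matrix (Fin 2) (Fin 2) ℝ) *ᵥ v = c • w) :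
    Literature.AnabelianGeometry.AbsoluteAnabelian.AbsTopIII.Cor_4_5
      (archLogFrobeniusData
        (geometricAutHolFieldFunctorRC fun Y : RC => Nonempty (Y ⟶ toRC.obj (pslQuotient Γ))))
      (archTelecoreData
        (geometricAutHolFieldFunctorRC fun Y : RC => Nonempty (Y ⟶ toRC.obj (pslQuotient Γ)))) :=
  RC.cor_4_5_geometric_mapsTo_pslQuotient_of_cusps Γ (hfin_of_isArithmetic Γ) hΓ hab hP hFC

/-! ### `Γ̄` arithmetic, free on finitely many (`≥ 2`) generators — the IUT shape -/

/-- ★★ **The ARITHMETIC PUNCTURED column in the IUT shape**: for `Γ̄ ≤ PSL₂(ℝ)` arithmetic, free on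
finitely many, `≥ 2`, generators, acting freely and properly discontinuously on `ℍ`, with (P)+(FC), the
geometric `EA` over `X₀ = ℍ/Γ̄` is ID-RIGID — abc-iut-L4-t14's p449027 closer with BOTH analytic binders
DISCHARGED (`hfin`: abc-iut-L4-t12; `hN`: abc-iut-L4-d1). [cite: MochizukiAbsTopIII2015, Proposition 4.2 (i) proof p.106] -/
theorem isIdRigid_EA_mapsTo_pslQuotient_of_cusps_of_isArithmetic_of_isFreeGroup [IsFreeGroup Γ]
    [((Γ.comap (QuotientGroup.mk' (Subgroup.center SL(2, ℝ)))).map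
      (toGL : SL(2, ℝ) →* GL (Fin 2) ℝ)).IsArithmetic]
    [Finite (IsFreeGroup.Generators Γ)] (h2 : 2 ≤ Nat.card (IsFreeGroup.Generators Γ))
    (hP : ∃ t : SL(2, ℝ), QuotientGroup.mk' (Subgroup.center SL(2, ℝ)) t ∈ Γ ∧
      (t : Matrix (Fin 2) (Fin 2) ℝ).IsParabolic)
    (hFC : ∃ F : Finset (Fin 2 → ℝ), ∀ t : SL(2, ℝ),
      QuotientGroup.mk' (Subgroup.center SL(2, ℝ)) t ∈ Γ → (t : Matrix (Fin 2) (Fin 2) ℝ).IsParabolic →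
      ∀ v : Fin 2 → ℝ, v ≠ 0 → (∃ c : ℝ, (t : Matrix (Fin 2) (Fin 2) ℝ) *ᵥ v = c • v) →
      ∃ g : SL(2, ℝ), QuotientGroup.mk' (Subgroup.center SL(2, ℝ)) g ∈ Γ ∧ ∃ w ∈ F, ∃ c : ℝ,
        (g : Matrix (Fin 2) (Fin 2) ℝ) *ᵥ v = c • w) :
    IsIdRigid (geometricAutHolFieldFunctor fun Y : HolRS => Nonempty (Y ⟶ pslQuotient Γ)).EA :=
  isIdRigid_EA_mapsTo_pslQuotient_of_cusps_of_isFreeGroup Γ (hfin_of_isArithmetic Γ) h2 hP hFC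

/-- ★★ **Cor 4.5 (i)–(v), ARITHMETIC PUNCTURED base, IUT shape** (`Γ̄` arithmetic, free on finitely many,
`≥ 2`, generators; (P)+(FC)) — both analytic binders discharged.
[cite: MochizukiAbsTopIII2015, Corollary 4.5 pp.107–109] -/
theorem cor_4_5_geometric_mapsTo_pslQuotient_of_cusps_of_isArithmetic_of_isFreeGroup [IsFreeGroup Γ]
    [((Γ.comap (QuotientGroup.mk' (Subgroup.center SL(2, ℝ)))).map
      (toGL : SL(2, ℝ) →* GL (Fin 2) ℝ)).IsArithmetic]
    [Finite (IsFreeGroup.Generators Γ)] (h2 : 2 ≤ Nat.card (IsFreeGroup.Generators Γ))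
    (hP : ∃ t : SL(2, ℝ), QuotientGroup.mk' (Subgroup.center SL(2, ℝ)) t ∈ Γ ∧
      (t : Matrix (Fin 2) (Fin 2) ℝ).IsParabolic)
    (hFC : ∃ F : Finset (Fin 2 → ℝ), ∀ t : SL(2, ℝ),
      QuotientGroup.mk' (Subgroup.center SL(2, ℝ)) t ∈ Γ → (t : Matrix (Fin 2) (Fin 2) ℝ).IsParabolic →
      ∀ v : Fin 2 → ℝ, v ≠ 0 → (∃ c : ℝ, (t : Matrix (Fin 2) (Fin 2) ℝ) *ᵥ v = c • v) →
      ∃ g : SL(2, ℝ), QuotientGroup.mk' (Subgroup.center SL(2, ℝ)) g ∈ Γ ∧ ∃ w ∈ F, ∃ c : ℝ,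
        (g : Matrix (Fin 2) (Fin 2) ℝ) *ᵥ v = c • w) :
    Literature.AnabelianGeometry.AbsoluteAnabelian.AbsTopIII.Cor_4_5
      (archLogFrobeniusData (geometricAutHolFieldFunctor fun Y : HolRS => Nonempty (Y ⟶ pslQuotient Γ)))
      (archTelecoreData (geometricAutHolFieldFunctor fun Y : HolRS => Nonempty (Y ⟶ pslQuotient Γ))) :=
  cor_4_5_geometric_mapsTo_pslQuotient_of_cusps_of_isFreeGroup Γ (hfin_of_isArithmetic Γ) h2 hP hFC

/-- ★★ **The PRINT-FAITHFUL (RC) column, ARITHMETIC PUNCTURED base, IUT shape** — abc-iut-L4-t14's p456078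
closer with both analytic binders discharged. [cite: MochizukiAbsTopIII2015, Proposition 4.2 (i) proof p.106] -/
theorem RC.isIdRigid_EA_mapsTo_pslQuotient_of_cusps_of_isArithmetic_of_isFreeGroup [IsFreeGroup Γ]
    [((Γ.comap (QuotientGroup.mk' (Subgroup.center SL(2, ℝ)))).map
      (toGL : SL(2, ℝ) →* GL (Fin 2) ℝ)).IsArithmetic]
    [Finite (IsFreeGroup.Generators Γ)] (h2 : 2 ≤ Nat.card (IsFreeGroup.Generators Γ))
    (hP : ∃ t : SL(2, ℝ), QuotientGroup.mk' (Subgroup.center SL(2, ℝ)) t ∈ Γ ∧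
      (t : Matrix (Fin 2) (Fin 2) ℝ).IsParabolic)
    (hFC : ∃ F : Finset (Fin 2 → ℝ), ∀ t : SL(2, ℝ),
      QuotientGroup.mk' (Subgroup.center SL(2, ℝ)) t ∈ Γ → (t : Matrix (Fin 2) (Fin 2) ℝ).IsParabolic →
      ∀ v : Fin 2 → ℝ, v ≠ 0 → (∃ c : ℝ, (t : Matrix (Fin 2) (Fin 2) ℝ) *ᵥ v = c • v) →
      ∃ g : SL(2, ℝ), QuotientGroup.mk' (Subgroup.center SL(2, ℝ)) g ∈ Γ ∧ ∃ w ∈ F, ∃ c : ℝ,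
        (g : Matrix (Fin 2) (Fin 2) ℝ) *ᵥ v = c • w) :
    IsIdRigid (geometricAutHolFieldFunctorRC fun Y : RC => Nonempty (Y ⟶ toRC.obj (pslQuotient Γ))).EA :=
  RC.isIdRigid_EA_mapsTo_pslQuotient_of_cusps_of_isFreeGroup Γ (hfin_of_isArithmetic Γ) h2 hP hFC

/-- ★★ **Cor 4.5 (i)–(v), PRINT-FAITHFUL morphisms, ARITHMETIC PUNCTURED base, IUT shape** — both
analytic binders discharged. [cite: MochizukiAbsTopIII2015, Corollary 4.5 pp.107–109] -/
theorem RC.cor_4_5_geometric_mapsTo_pslQuotient_of_cusps_of_isArithmetic_of_isFreeGroup [IsFreeGroup Γ]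
    [((Γ.comap (QuotientGroup.mk' (Subgroup.center SL(2, ℝ)))).map
      (toGL : SL(2, ℝ) →* GL (Fin 2) ℝ)).IsArithmetic]
    [Finite (IsFreeGroup.Generators Γ)] (h2 : 2 ≤ Nat.card (IsFreeGroup.Generators Γ))
    (hP : ∃ t : SL(2, ℝ), QuotientGroup.mk' (Subgroup.center SL(2, ℝ)) t ∈ Γ ∧
      (t : Matrix (Fin 2) (Fin 2) ℝ).IsParabolic)
    (hFC : ∃ F : Finset (Fin 2 → ℝ), ∀ t : SL(2, ℝ),
      QuotientGroup.mk' (Subgroup.center SL(2, ℝ)) t ∈ Γ → (t : Matrix (Fin 2) (Fin 2) ℝ).IsParabolic →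
      ∀ v : Fin 2 → ℝ, v ≠ 0 → (∃ c : ℝ, (t : Matrix (Fin 2) (Fin 2) ℝ) *ᵥ v = c • v) →
      ∃ g : SL(2, ℝ), QuotientGroup.mk' (Subgroup.center SL(2, ℝ)) g ∈ Γ ∧ ∃ w ∈ F, ∃ c : ℝ,
        (g : Matrix (Fin 2) (Fin 2) ℝ) *ᵥ v = c • w) :
    Literature.AnabelianGeometry.AbsoluteAnabelian.AbsTopIII.Cor_4_5
      (archLogFrobeniusData
        (geometricAutHolFieldFunctorRC fun Y : RC => Nonempty (Y ⟶ toRC.obj (pslQuotient Γ))))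
      (archTelecoreData
        (geometricAutHolFieldFunctorRC fun Y : RC => Nonempty (Y ⟶ toRC.obj (pslQuotient Γ)))) :=
  RC.cor_4_5_geometric_mapsTo_pslQuotient_of_cusps_of_isFreeGroup Γ (hfin_of_isArithmetic Γ) h2 hP hFC

end HolRS

end Literature.AnabelianGeometry.AbsoluteAnabelian

end

-- tree-health (abc-iut-w6-d081 g5, 2026-08-26T20:48Z): comment-only re-land of a SKIPPED ACCEPT (p465168 accepted 19:44:35Z; no hub olean after 60 min while the lane builds p90 < 2 min);
-- declarations byte-identical to the accepted version; purpose = trigger the rebuild. No content change.
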